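import Summits.Ventures.QEC.Census.TwoBGA.TwoBGAOneSided06
import Summits.Ventures.QEC.Census.BB.BBRows
import Summits.Ventures.QEC.Census.BB.Claims
import Literature.InformationTheory.QuantumCodes.TwoBlockConnectedComponents
import Literature.InformationTheory.QuantumCodes.TwoBlockToricLayout
import Literature.InformationTheory.QuantumCodes.TwoBlockWheelComponents
import Literature.InformationTheory.QuantumCodes.TwoBlockRootParameters
import HarnessLib
import HarnessLib.Audit.Tags

/-!
# Census rows as TYPED two-block codes `QC(A, B)` on `ℤ_ℓ × ℤ_m` — bridge batch `TwoBGAOneSidedQC05` (1 row(s), kernel tier)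

Family: abelian two-block over ℤ_ℓ × ℤ_m (qec census one-module KERNEL-std rows: qec-search-7 certificate modules, MITM and
Brouwer–Zimmermann/automorphism formats). For each census row below (an EXPLICIT matrix code
`cert.code _ = CSSCode.ofMatrices (rowMatrix n cert.HX) (rowMatrix n cert.HZ)` with `IsCode n k d` certified in its own module), this file
puts the row's CONSTRUCTION into the kernel statement, as in the pilot `Census/BB/A1s_n144_k32_4addf704QC.lean` (p511732) and the
gen-4 batches `A1sRowsQC1–5` / `TwoBGARowsQC1–4`: monomial lists `la`, `lb` (from the certificate's construction record — the
docstring's `A_terms`/`B_terms` or the census row id `2bga-lℓmm-A…-B…`, monomials `xⁱyʲ` as `[i,j]`, convention of BCGMRY24 §4 =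
`BivariateBicycleCodes.lean`; the index identity was ALSO re-verified row-for-row by the emitter before filing), the typed object
`qc : BB.Code ℓ m := ⟨polyL la, polyL lb⟩`, the kernel INDEX IDENTITIES `cert.HX = BBRows.rowsX la lb`, `cert.HZ = BBRows.rowsZ la lb`
(`decide`; verified row generator `Census/BB/BBRows.lean`, p502918), the flat identities via `BBRows.rowMatrix_rowsX/Z`, the transport of
the row's own `dZ_eq` and `k` (its `k_eq`, or the `k`-component of its `isCode`) by type-05's `BB.Code.dZ_eq_of_flat` / `k_eq_of_flat` to
`qc_hasParams : BB.HasParams qc n k d` (census predicate of family BB, `Census/BB/Claims.lean`, distance EXACT) and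
`qc_isCode : qc.css.IsCode n k d`; and the census LAYOUT columns (Bravyi et al. 2024 §4 — arXiv:2308.07915: Lemma 2 p0010 L49, Lemma 3 p0011 L9, Lemma 4 p0011 L28; locators per qec-ref-2 2026-08-27T10:27Z) as KERNEL verdicts: «connected» —
`qc_tannerGraph_connected` (Lemma 3, `BB.Code.tannerGraph_connected_of_unit_mem`, explicit multiples of exponent differences) or
`qc_tannerGraph_not_connected` + `card_expDiffSubgroup` + `qc_card_connectedComponent` (`⟨S⟩` = an explicit finite carrier `diffList`,
both inclusions certified; exact component count by Lemma 3 (ii), `BB.Code.card_connectedComponent_mul_card`; by the tree's connected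
normal form `TwoBlockConnectedComponents.lean` such a code is the disjoint union of that many copies of its root code, whose parameters
`[[n/c, k/c, d]]` and connectedness are certified here as `root_isCode` via `TwoBlockRootParameters.lean`); «toric layout» —
`qc_hasToricLayoutWith μ λ` (Lemma 4, `BB.Code.hasToricLayoutWith_of_exponents`; omitted when its sufficient condition has no witness);
«wheel layers» — `qc_wheel_layers` (Lemma 2 minus planarity, `BB.Code.exists_wheel_layers`, weight-(3,3) rows only):

* `A1p_n96_k8_3e9983cd` = `QC(1 + y + xy^5, 1 + y^5 + xy^4)` on `ℤ_2 × ℤ_24`: `[[96, 8, 8]]`; Tanner graph connected; wheel layers 12/48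

No new certificate — tier KERNEL, axioms standard, no `native_decide`. HONEST FRAMING: identifies already-certified census objects with
named algebraic constructions and decides structural (graph) properties; the census comparator columns (printed values, optimality
words) are not touched; for disconnected rows the root code is identified abstractly over `↥⟨S⟩` (not re-indexed to a named `QC(A',B')`,
not identified with a smaller census row); planarity/thickness is not asserted. Generated by
qec-type-05 gen 6's `tools/emit_qc_bridge3.py` (gen 5's emitter + sibling-data rows + ℓ = 1 connectivity) + `tools/conn_cert.py` (HOME/lean/type-05/tools/).
-/

namespace Summit.Ventures.QEC.Census.A1p_n96_k8_3e9983cd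

open Matrix Literature.InformationTheory.QuantumCodes BBRows

/-- Monomials of `A = 1 + y + xy^5` (construction `A_terms = [[0, 0], [0, 1], [1, 5]]`, from the census generator file `census/search-3/gens/a1plus/A1p_n96_k8_3e9983cd.json` (matrix_sha256 `3e9983cdb2a31a60…`; `A = 1+y+x*y^5`, `B = 1+y^5+x*y^4`)). DATA. -/
def la : List (BB.Mono 2 24) := [(Fin.ofNat 2 0, Fin.ofNat 24 0), (Fin.ofNat 2 0, Fin.ofNat 24 1), (Fin.ofNat 2 1, Fin.ofNat 24 5)]

/-- Monomials of `B = 1 + y^5 + xy^4` (construction `B_terms = [[0, 0], [0, 5], [1, 4]]`). DATA. -/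
def lb : List (BB.Mono 2 24) := [(Fin.ofNat 2 0, Fin.ofNat 24 0), (Fin.ofNat 2 0, Fin.ofNat 24 5), (Fin.ofNat 2 1, Fin.ofNat 24 4)]

/-- The census row's code as a TYPED two-block code `QC(1 + y + xy^5, 1 + y^5 + xy^4)` on `ℤ_2 × ℤ_24` (`BB.Code 2 24`). (definition) -/
def qc : BB.Code 2 24 := ⟨polyL la, polyL lb⟩

set_option maxRecDepth 100000 in
/-- INDEX IDENTITY, `X` side, in the kernel: the certificate's `H^X` rows ARE the `X`-check words of `qc` (`decide +kernel`). -/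
theorem HX_eq_rowsX : A1p_n96_k8_3e9983cd.cert.HX = rowsX la lb := by
  decide +kernel

set_option maxRecDepth 100000 in
/-- INDEX IDENTITY, `Z` side. -/
theorem HZ_eq_rowsZ : A1p_n96_k8_3e9983cd.cert.HZ = rowsZ la lb := by
  decide +kernel

set_option maxRecDepth 100000 in
/-- The certificate's flat `H^X` is `qc.HXFlat`. -/
theorem rowMatrix_HX_eq : rowMatrix 96 A1p_n96_k8_3e9983cd.cert.HX = qc.HXFlat := by
  have cast : ∀ {H H' : List ℕ} (e : H = H'),
      rowMatrix 96 H = (rowMatrix 96 H').submatrix (Fin.cast (congrArg List.length e)) id := by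
    intro H H' e; subst e; rfl
  exact (cast HX_eq_rowsX).trans (rowMatrix_rowsX qc (LA := la) (LB := lb) rfl rfl)

set_option maxRecDepth 100000 in
/-- The certificate's flat `H^Z` is `qc.HZFlat`. -/
theorem rowMatrix_HZ_eq : rowMatrix 96 A1p_n96_k8_3e9983cd.cert.HZ = qc.HZFlat := by
  have cast : ∀ {H H' : List ℕ} (e : H = H'),
      rowMatrix 96 H = (rowMatrix 96 H').submatrix (Fin.cast (congrArg List.length e)) id := by
    intro H H' e; subst e; rfl
  exact (cast HZ_eq_rowsZ).trans (rowMatrix_rowsZ qc (LA := la) (LB := lb) rfl rfl)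

set_option maxRecDepth 100000 in
/-- `d^Z (qc) = 8`, transported from the census certificate (`A1p_n96_k8_3e9983cd.dZ_eq`) by `BB.Code.dZ_eq_of_flat`. -/
theorem qc_dZ : qc.css.dZ = 8 :=
  (qc.dZ_eq_of_flat (D := A1p_n96_k8_3e9983cd.cert.code (A1p_n96_k8_3e9983cd.cert.commOK_of_checkStructure A1p_n96_k8_3e9983cd.checkStructure_ok))
    rowMatrix_HX_eq rowMatrix_HZ_eq).symm.trans A1p_n96_k8_3e9983cd.dZ_eq

set_option maxRecDepth 100000 in
/-- `k (qc) = 8`, transported from the census certificate (the `k`-component of `A1p_n96_k8_3e9983cd.isCode`) by `BB.Code.k_eq_of_flat`. -/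
theorem qc_k : qc.k = 8 :=
  (qc.k_eq_of_flat (D := A1p_n96_k8_3e9983cd.cert.code (A1p_n96_k8_3e9983cd.cert.commOK_of_checkStructure A1p_n96_k8_3e9983cd.checkStructure_ok))
    rowMatrix_HX_eq rowMatrix_HZ_eq).symm.trans A1p_n96_k8_3e9983cd.isCode.2.1

/-- **`QC(1 + y + xy^5, 1 + y^5 + xy^4)` on `ℤ_2 × ℤ_24` has parameters `[[96, 8, 8]]`** (distance exact; `BB.HasParams`) — the census row
`A1p_n96_k8_3e9983cd` read as a statement about the construction. KERNEL. -/
theorem qc_hasParams : Summit.Ventures.QEC.BB.HasParams qc 96 8 8 :=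
  BB.hasParams_of_dZ (by simp only [BB.numQubits_eq]) qc_k qc_dZ

/-- The same in the generic census vocabulary: `qc.css.IsCode 96 8 8`. -/
theorem qc_isCode : qc.css.IsCode 96 8 8 :=
  (BB.hasParams_iff_isCode (by decide)).1 qc_hasParams

set_option maxRecDepth 100000 in
/-- **The Tanner graph of `qc` is connected** (Bravyi et al. 2024 Lemma 3 / `BB.Code.tannerGraph_connected_of_unit_mem`): `x = (1,0)`
and `y = (0,1)` are explicit combinations of exponent differences inside `A` or inside `B` (found by qec-type-05's tools/conn_cert.py,
re-checked by `decide`). Census column «connected» for this row, KERNEL. -/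
theorem qc_tannerGraph_connected : qc.css.tannerGraph.Connected := by
  refine qc.tannerGraph_connected_of_unit_mem (fun h => absurd (congrFun h ((0 : Fin 2), (0 : Fin 24))) (by decide))
    (fun h => absurd (congrFun h ((0 : Fin 2), (0 : Fin 24))) (by decide)) ?_ ?_
  · have e : (((1 : Fin 2), (0 : Fin 24)) : BB.Mono 2 24) = (1 : ℕ) • ((((0 : Fin 2), (0 : Fin 24))) - (0, 1)) + (19 : ℕ) • ((((0 : Fin 2), (0 : Fin 24))) - (1, 5)) := by decide
    rw [e]
    exact (AddSubgroup.add_mem _ (AddSubgroup.nsmul_mem _ (qc.sub_mem_expDiffSubgroup_A (by decide) (by decide)) 1) (AddSubgroup.nsmul_mem _ (qc.sub_mem_expDiffSubgroup_A (by decide) (by decide)) 19))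
  · have e : (((0 : Fin 2), (1 : Fin 24)) : BB.Mono 2 24) = (23 : ℕ) • ((((0 : Fin 2), (0 : Fin 24))) - (0, 1)) := by decide
    rw [e]
    exact (AddSubgroup.nsmul_mem _ (qc.sub_mem_expDiffSubgroup_A (by decide) (by decide)) 23)

set_option maxRecDepth 100000 in
/-- **`qc`**: Tanner graph = edge-disjoint union of two layers whose components are wheel graphs `prismGraph 12` (`A₃A₂ᵀ` of order
`6`) and `prismGraph 48` (`B₂B₁ᵀ` of order `24`) — BCGMRY24 Lemma 2 minus planarity (`BB.Code.exists_wheel_layers`). KERNEL. -/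
theorem qc_wheel_layers :
    ∃ ΓA ΓB : SimpleGraph ((BB.Mono 2 24 ⊕ BB.Mono 2 24) ⊕ (BB.Mono 2 24 ⊕ BB.Mono 2 24)),
    qc.css.tannerGraph = ΓA ⊔ ΓB ∧ Disjoint ΓA ΓB ∧
    (∀ K : ΓA.ConnectedComponent, Nonempty (K.toSimpleGraph ≃g prismGraph 12)) ∧
    (∀ K : ΓB.ConnectedComponent, Nonempty (K.toSimpleGraph ≃g prismGraph 48)) := by
  have hA : ∀ g : BB.Mono 2 24, qc.A g ≠ 0 ↔ g = ((0 : Fin 2), (0 : Fin 24)) ∨ g = ((0 : Fin 2), (1 : Fin 24)) ∨ g = ((1 : Fin 2), (5 : Fin 24)) := by decide +kernel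
  have hB : ∀ g : BB.Mono 2 24, qc.B g ≠ 0 ↔ g = ((0 : Fin 2), (0 : Fin 24)) ∨ g = ((0 : Fin 2), (5 : Fin 24)) ∨ g = ((1 : Fin 2), (4 : Fin 24)) := by decide +kernel
  have h := qc.exists_wheel_layers (g₁ := ((0 : Fin 2), (0 : Fin 24))) (g₂ := ((0 : Fin 2), (1 : Fin 24))) (g₃ := ((1 : Fin 2), (5 : Fin 24))) (h₁ := ((0 : Fin 2), (0 : Fin 24)))
    (h₂ := ((0 : Fin 2), (5 : Fin 24))) (h₃ := ((1 : Fin 2), (4 : Fin 24))) (by decide) (by decide) (by decide) (by decide) (by decide) (by decide) hA hB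
  have e1 : addOrderOf (((1 : Fin 2), (5 : Fin 24)) - (0, 1)) = 6 := (addOrderOf_eq_iff (by norm_num)).mpr (by decide)
  have e2 : addOrderOf (((0 : Fin 2), (5 : Fin 24)) - (0, 0)) = 24 := (addOrderOf_eq_iff (by norm_num)).mpr (by decide)
  rw [e1, e2] at h
  exact h

end Summit.Ventures.QEC.Census.A1p_n96_k8_3e9983cd
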